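import Summits.NavierStokesRegularity.NavierStokesRegularity.Theorems.WakeRatchetExtractionLaw

/-!
# WakeRatchetExtractionClock — LINE g9-1 «clocked frames», part 6/7: ⟨22744⟩ `WakeRatchet.MinimalBlowupExtraction`

Ideator ns-idea-1 g9, LINE g9-1 «clocked frames» (critic of record idea-crit-3): part 6 of 7 of the split landing kit of
`extraction_proved.lean` (sha16 849d037365163546, the sorry-free proof of route item ⟨stmt-NavierStokesRegularity-22744⟩
`WakeRatchet.MinimalBlowupExtraction`), cut at the author's seams with every declaration VERBATIM; parts chain by import
(1 Ascoli → 2 Frames → 3 FrameLip → 4 Action → 5 Law → 6 Clock → 7 MinimalBlowupExtraction).  MODEL lattice only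
(Tao 2016 averaged Navier–Stokes cascade); no summit is proved by a line — part 7 closes ONE crux (K2) of route WakeRatchet.

This part: The two-sided firing clock: `stubClock_holds : StubClock` (re-selection `τ_m := max (t_m − δ_m) 0`, energy Lipschitz
bound from upper pinning, amplitude floor).
-/

noncomputable section

set_option linter.dupNamespace false

namespace Summit.NavierStokesRegularity.NavierStokesRegularity.Cruxes.MinimalBlowupExtraction.ClockedFrames

open Set Filter Topology MeasureTheory
open scoped RealInnerProductSpace
open Literature.Analysis.FluidPDE Literature.Analysis.FluidPDE.TaoCascade
open Summit.NavierStokesRegularity.NavierStokesRegularity.Cruxes.MinimalBlowupExtraction.Extraction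
  (exists_subseq_continuousLimit_param)
open Summit.NavierStokesRegularity.NavierStokesRegularity.Theorems.DSSOneShift
  (hasDerivWithinAt_shellVec bigLam_zpow_eq_rpow)
open Summit.NavierStokesRegularity.NavierStokesRegularity.Theorems.WakeRatchetCritical
  (tableQ_smul tableA_smul tableB_smul_smul continuous_tableB)
open Summit.NavierStokesRegularity.NavierStokesRegularity.Theorems.TransitMassLedgerEnergy
  (continuous_tableQ continuous_tableA continuous_tableB_comp)
open Summit.NavierStokesRegularity.NavierStokesRegularity.Cruxes.MinimalBlowupExtraction.TableCont

/-! ## The derivative of a shell and of its energy inside `[0,T)` -/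

variable {ε₀ : ℝ} {α : Fin 4 → Fin 4 → Fin 4 → ℤ × ℤ × ℤ → ℝ} {X₀ : Fin 4 → ℝ} {ν T C c : ℝ}
  {X : Fin 4 → ℤ → ℝ → ℝ}

/-- Inside `[0,T)` the one-sided law is a genuine derivative within `[0,T)`. -/
theorem hasDerivWithinAt_comp (hP : Pinned ε₀ α X₀ ν T C c X) (i : Fin 4) (n : ℤ) {t : ℝ}
    (ht : t ∈ Ico 0 T) :
    HasDerivWithinAt (X i n) (quadTerm ε₀ α X i n t - ν * (1 + ε₀) ^ ((2 : ℝ) * n) * X i n t)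
      (Ico 0 T) t := by
  obtain ⟨-, -, -, hcd, -, -, hlaw, -⟩ := hP
  have hd : DifferentiableWithinAt ℝ (X i n) (Ico 0 T) t :=
    (hcd i n).differentiableOn one_ne_zero t ht
  have h1 := hd.hasDerivWithinAt
  have h2 : derivWithin (X i n) (Ico 0 T) t = derivWithin (X i n) (Ici 0) t := by
    rw [← Set.Ici_inter_Iio, derivWithin_inter (Iio_mem_nhds ht.2)]
  rw [h2, hlaw i n t ht.1 ht.2] at h1
  exact h1

/-- The shell energy `‖X_n‖²` has derivative `2⟪X_n, Ẋ_n⟫` within `[0,T)`. -/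
theorem hasDerivWithinAt_energy (hP : Pinned ε₀ α X₀ ν T C c X) (n : ℤ) {t : ℝ} (ht : t ∈ Ico 0 T) :
    HasDerivWithinAt (fun s => ‖shellVec X n s‖ ^ 2) (2 * ⟪shellVec X n t, dvec ε₀ α ν X n t⟫)
      (Ico 0 T) t := by
  have hv : HasDerivWithinAt (shellVec X n)
      (WithLp.toLp 2 fun i => quadTerm ε₀ α X i n t - ν * (1 + ε₀) ^ ((2 : ℝ) * n) * X i n t)
      (Ico 0 T) t :=
    hasDerivWithinAt_shellVec fun i => hasDerivWithinAt_comp hP i n ht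
  have heq : (WithLp.toLp 2 fun i => quadTerm ε₀ α X i n t - ν * (1 + ε₀) ^ ((2 : ℝ) * n) * X i n t :
      Em 4) = dvec ε₀ α ν X n t := by
    ext j
    simp [dvec, shellVec, smul_eq_mul]
  have h := hv.norm_sq
  rw [heq] at h
  exact h

/-! ## The size of the velocity: Lipschitz bound of the shell energy from upper pinning -/

/-- `(Λ^m)² = ((1+ε₀)^m)^5`. -/
theorem bigLam_pow_sq (hε : 0 < ε₀) (m : ℕ) : (bigLam ε₀ ^ m) ^ 2 = ((1 + ε₀) ^ m) ^ 5 := by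
  rw [← pow_mul, show m * 2 = 2 * m from Nat.mul_comm _ _, pow_mul, bigLam_sq hε.le, ← pow_mul,
    show 5 * m = m * 5 from Nat.mul_comm _ _, pow_mul]

/-- The `A`-term after the weighted AM–GM split: `(Λ^{m-1}‖X_{m-1}‖²)² ≤ ((1+ε₀)^m)³ C²`
(shell `m − 1 = −1` is empty for `m = 0`). -/
theorem amTerm_sq_le (hε : 0 < ε₀) (hneg : ∀ (i : Fin 4) (n : ℤ) (t : ℝ), n < 0 → X i n t = 0)
    (hpin : ∀ (n : ℤ) (t : ℝ), 0 ≤ t → t < T → (1 + ε₀) ^ n * ‖shellVec X n t‖ ^ 2 ≤ C)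
    (m : ℕ) {t : ℝ} (ht0 : 0 ≤ t) (htT : t < T) :
    (bigLam ε₀ ^ ((m : ℤ) - 1) * ‖shellVec X ((m : ℤ) - 1) t‖ ^ 2) ^ 2 ≤
      ((1 + ε₀) ^ m) ^ 3 * C ^ 2 := by
  have hb1 : 1 ≤ 1 + ε₀ := by linarith
  cases m with
  | zero =>
    have h0 : shellVec X (((0 : ℕ) : ℤ) - 1) t = 0 := by
      ext j
      simp [hneg j (-1) t (by norm_num)]
    rw [h0, norm_zero]
    simp only [ne_eq, OfNat.ofNat_ne_zero, not_false_eq_true, zero_pow, mul_zero, pow_zero, one_pow,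
      one_mul]
    positivity
  | succ k =>
    have e : ((k + 1 : ℕ) : ℤ) - 1 = (k : ℤ) := by push_cast; ring
    rw [e, zpow_natCast]
    have hpk : (1 + ε₀) ^ k * ‖shellVec X (k : ℤ) t‖ ^ 2 ≤ C := by
      have h := hpin (k : ℤ) t ht0 htT
      rwa [zpow_natCast] at h
    have e1 : (bigLam ε₀ ^ k * ‖shellVec X (k : ℤ) t‖ ^ 2) ^ 2 =
        ((1 + ε₀) ^ k) ^ 3 * ((1 + ε₀) ^ k * ‖shellVec X (k : ℤ) t‖ ^ 2) ^ 2 := by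
      rw [mul_pow, bigLam_pow_sq hε k]; ring
    rw [e1]
    have h3 : ((1 + ε₀) ^ k) ^ 3 ≤ ((1 + ε₀) ^ (k + 1)) ^ 3 :=
      pow_le_pow_left₀ (by positivity) (pow_le_pow_right₀ hb1 (Nat.le_succ k)) 3
    have h4 : ((1 + ε₀) ^ k * ‖shellVec X (k : ℤ) t‖ ^ 2) ^ 2 ≤ C ^ 2 :=
      pow_le_pow_left₀ (by positivity) hpk 2
    exact mul_le_mul h3 h4 (by positivity) (by positivity)

/-- The uniform Lipschitz constant of the clock (`+1` keeps it positive). -/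
def clockK (α : Fin 4 → Fin 4 → Fin 4 → ℤ × ℤ × ℤ → ℝ) (ν C : ℝ) : ℝ :=
  (shiftConst α (0, 0, 0) + (shiftConst α (1, 0, 0) + shiftConst α (0, 1, 0)) + shiftConst α (0, 0, 1)) *
      (C + C ^ 2) + 2 * ν * C + 1

/-- The clock constant `clockK α ν C` is positive. -/
theorem clockK_pos (α : Fin 4 → Fin 4 → Fin 4 → ℤ × ℤ × ℤ → ℝ) {ν C : ℝ} (hν : 0 ≤ ν) (hC : 0 ≤ C) :
    0 < clockK α ν C := by
  unfold clockK
  have h1 : 0 ≤ (shiftConst α (0, 0, 0) + (shiftConst α (1, 0, 0) + shiftConst α (0, 1, 0)) +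
      shiftConst α (0, 0, 1)) * (C + C ^ 2) :=
    mul_nonneg (by linarith [shiftConst_nonneg α (0, 0, 0), shiftConst_nonneg α (1, 0, 0),
      shiftConst_nonneg α (0, 1, 0), shiftConst_nonneg α (0, 0, 1)]) (by positivity)
  have h2 : 0 ≤ 2 * ν * C := by positivity
  linarith

/-- Pure arithmetic of the weighted AM–GM split `2xy ≤ w²x² + y²/w²`. -/
theorem arith_bound {w a ap am L L' sQ sB sA nu CC : ℝ} (hw : 0 < w) (hnu : 0 ≤ nu) (hsQ : 0 ≤ sQ)
    (hsB : 0 ≤ sB) (hsA : 0 ≤ sA) (hp0 : w * a ^ 2 ≤ CC) (B1 : w ^ 2 * a ^ 2 ≤ w * CC)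
    (B2 : (L * a ^ 2) ^ 2 / w ^ 2 ≤ w * CC ^ 2) (B3 : w ^ 2 * ap ^ 2 ≤ w * CC)
    (B4 : (L' * am ^ 2) ^ 2 / w ^ 2 ≤ w * CC ^ 2) :
    2 * a * (L * (sQ * a ^ 2 + sB * ap * a) + L' * (sA * am ^ 2) + nu * w ^ 2 * a) ≤
      ((sQ + sB + sA) * (CC + CC ^ 2) + 2 * nu * CC) * w := by
  have amgm : ∀ x y : ℝ, 2 * x * y ≤ w ^ 2 * x ^ 2 + y ^ 2 / w ^ 2 := by
    intro x y
    have h := two_mul_le_add_sq (w * x) (y / w)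
    have e : 2 * (w * x) * (y / w) = 2 * x * y := by field_simp
    rw [e, mul_pow, div_pow] at h
    exact h
  have i1 : 2 * a * (L * a ^ 2) ≤ w * CC + w * CC ^ 2 := by linarith [amgm a (L * a ^ 2)]
  have i2 : 2 * ap * (L * a ^ 2) ≤ w * CC + w * CC ^ 2 := by linarith [amgm ap (L * a ^ 2)]
  have i3 : 2 * a * (L' * am ^ 2) ≤ w * CC + w * CC ^ 2 := by linarith [amgm a (L' * am ^ 2)]
  have i4 : 2 * nu * w * (w * a ^ 2) ≤ 2 * nu * w * CC :=
    mul_le_mul_of_nonneg_left hp0 (by positivity)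
  have j1 := mul_le_mul_of_nonneg_left i1 hsQ
  have j2 := mul_le_mul_of_nonneg_left i2 hsB
  have j3 := mul_le_mul_of_nonneg_left i3 hsA
  calc 2 * a * (L * (sQ * a ^ 2 + sB * ap * a) + L' * (sA * am ^ 2) + nu * w ^ 2 * a)
      = sQ * (2 * a * (L * a ^ 2)) + sB * (2 * ap * (L * a ^ 2)) + sA * (2 * a * (L' * am ^ 2)) +
          2 * nu * w * (w * a ^ 2) := by ring
    _ ≤ sQ * (w * CC + w * CC ^ 2) + sB * (w * CC + w * CC ^ 2) + sA * (w * CC + w * CC ^ 2) +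
          2 * nu * w * CC := by linarith
    _ = ((sQ + sB + sA) * (CC + CC ^ 2) + 2 * nu * CC) * w := by ring

/-- **The derivative bound**: `|d/dt ‖X_m‖²| ≤ K (1+ε₀)^m` on `[0,T)`, `K` uniform in `m`, from UPPER pinning. -/
theorem deriv_bound (hP : Pinned ε₀ α X₀ ν T C c X) (hε : 0 < ε₀) (m : ℕ) {t : ℝ} (ht : t ∈ Ico 0 T) :
    |2 * ⟪shellVec X (m : ℤ) t, dvec ε₀ α ν X m t⟫| ≤ clockK α ν C * (1 + ε₀) ^ m := by
  obtain ⟨hν, hT, hc, hcd, hX0, hneg, hlaw, htypeI, hint, hpin, hfire⟩ := hP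
  have hb : 0 < 1 + ε₀ := by linarith
  have hb1 : 1 ≤ 1 + ε₀ := by linarith
  have hw0 : 0 < (1 + ε₀) ^ m := pow_pos hb m
  -- pinned products
  have hp0 : (1 + ε₀) ^ m * ‖shellVec X (m : ℤ) t‖ ^ 2 ≤ C := by
    have h := hpin (m : ℤ) t ht.1 ht.2
    rwa [zpow_natCast] at h
  have hp1 : (1 + ε₀) ^ (m + 1) * ‖shellVec X ((m : ℤ) + 1) t‖ ^ 2 ≤ C := by
    have h := hpin ((m : ℤ) + 1) t ht.1 ht.2
    rwa [show ((m : ℤ) + 1) = ((m + 1 : ℕ) : ℤ) by push_cast; ring, zpow_natCast] at h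
  have hC : 0 ≤ C := le_trans (by positivity) hp0
  -- the size of the velocity vector
  have hw2r : (1 + ε₀) ^ ((2 : ℝ) * ((m : ℤ) : ℝ)) = ((1 + ε₀) ^ m) ^ 2 := by
    rw [show (2 : ℝ) * ((m : ℤ) : ℝ) = ((2 * m : ℕ) : ℝ) by push_cast; ring, Real.rpow_natCast,
      pow_mul']
  have hq := norm_qvec_le (α := α) (X := X) hε (m : ℤ) t
  have hd : ‖dvec ε₀ α ν X m t‖ ≤
      bigLam ε₀ ^ (m : ℤ) * (shiftConst α (0, 0, 0) * ‖shellVec X (m : ℤ) t‖ ^ 2 +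
        (shiftConst α (1, 0, 0) + shiftConst α (0, 1, 0)) * ‖shellVec X ((m : ℤ) + 1) t‖ *
          ‖shellVec X (m : ℤ) t‖) +
      bigLam ε₀ ^ ((m : ℤ) - 1) * (shiftConst α (0, 0, 1) * ‖shellVec X ((m : ℤ) - 1) t‖ ^ 2) +
      ν * ((1 + ε₀) ^ m) ^ 2 * ‖shellVec X (m : ℤ) t‖ := by
    unfold dvec
    calc ‖shellVec (fun i k s => quadTerm ε₀ α X i k s) (m : ℤ) t -
            (ν * (1 + ε₀) ^ ((2 : ℝ) * ((m : ℤ) : ℝ))) • shellVec X (m : ℤ) t‖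
        ≤ ‖shellVec (fun i k s => quadTerm ε₀ α X i k s) (m : ℤ) t‖ +
            ‖(ν * (1 + ε₀) ^ ((2 : ℝ) * ((m : ℤ) : ℝ))) • shellVec X (m : ℤ) t‖ := norm_sub_le _ _
      _ = ‖shellVec (fun i k s => quadTerm ε₀ α X i k s) (m : ℤ) t‖ +
            ν * ((1 + ε₀) ^ m) ^ 2 * ‖shellVec X (m : ℤ) t‖ := by
          rw [norm_smul, hw2r, Real.norm_of_nonneg (by positivity)]
      _ ≤ _ := by linarith [hq]
  -- Cauchy–Schwarz
  have hin : |2 * ⟪shellVec X (m : ℤ) t, dvec ε₀ α ν X m t⟫| ≤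
      2 * ‖shellVec X (m : ℤ) t‖ * ‖dvec ε₀ α ν X m t‖ := by
    rw [abs_mul, abs_two]
    have h := abs_real_inner_le_norm (shellVec X (m : ℤ) t) (dvec ε₀ α ν X m t)
    nlinarith [h]
  -- the four AM–GM inputs
  have B1 : ((1 + ε₀) ^ m) ^ 2 * ‖shellVec X (m : ℤ) t‖ ^ 2 ≤ (1 + ε₀) ^ m * C := by
    have e : ((1 + ε₀) ^ m) ^ 2 * ‖shellVec X (m : ℤ) t‖ ^ 2 =
        (1 + ε₀) ^ m * ((1 + ε₀) ^ m * ‖shellVec X (m : ℤ) t‖ ^ 2) := by ring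
    rw [e]; exact mul_le_mul_of_nonneg_left hp0 hw0.le
  have B2 : (bigLam ε₀ ^ (m : ℤ) * ‖shellVec X (m : ℤ) t‖ ^ 2) ^ 2 / ((1 + ε₀) ^ m) ^ 2 ≤
      (1 + ε₀) ^ m * C ^ 2 := by
    rw [zpow_natCast, div_le_iff₀ (by positivity)]
    have e : (bigLam ε₀ ^ m * ‖shellVec X (m : ℤ) t‖ ^ 2) ^ 2 =
        ((1 + ε₀) ^ m) ^ 3 * ((1 + ε₀) ^ m * ‖shellVec X (m : ℤ) t‖ ^ 2) ^ 2 := by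
      rw [mul_pow, bigLam_pow_sq hε m]; ring
    rw [e, show (1 + ε₀) ^ m * C ^ 2 * ((1 + ε₀) ^ m) ^ 2 = ((1 + ε₀) ^ m) ^ 3 * C ^ 2 by ring]
    exact mul_le_mul_of_nonneg_left (pow_le_pow_left₀ (by positivity) hp0 2) (by positivity)
  have B3 : ((1 + ε₀) ^ m) ^ 2 * ‖shellVec X ((m : ℤ) + 1) t‖ ^ 2 ≤ (1 + ε₀) ^ m * C := by
    have e : ((1 + ε₀) ^ m) ^ 2 * ‖shellVec X ((m : ℤ) + 1) t‖ ^ 2 * (1 + ε₀) =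
        (1 + ε₀) ^ m * ((1 + ε₀) ^ (m + 1) * ‖shellVec X ((m : ℤ) + 1) t‖ ^ 2) := by ring
    calc ((1 + ε₀) ^ m) ^ 2 * ‖shellVec X ((m : ℤ) + 1) t‖ ^ 2
        ≤ ((1 + ε₀) ^ m) ^ 2 * ‖shellVec X ((m : ℤ) + 1) t‖ ^ 2 * (1 + ε₀) :=
          le_mul_of_one_le_right (by positivity) hb1
      _ = (1 + ε₀) ^ m * ((1 + ε₀) ^ (m + 1) * ‖shellVec X ((m : ℤ) + 1) t‖ ^ 2) := e
      _ ≤ (1 + ε₀) ^ m * C := mul_le_mul_of_nonneg_left hp1 hw0.le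
  have B4 : (bigLam ε₀ ^ ((m : ℤ) - 1) * ‖shellVec X ((m : ℤ) - 1) t‖ ^ 2) ^ 2 / ((1 + ε₀) ^ m) ^ 2 ≤
      (1 + ε₀) ^ m * C ^ 2 := by
    rw [div_le_iff₀ (by positivity),
      show (1 + ε₀) ^ m * C ^ 2 * ((1 + ε₀) ^ m) ^ 2 = ((1 + ε₀) ^ m) ^ 3 * C ^ 2 by ring]
    exact amTerm_sq_le hε hneg hpin m ht.1 ht.2
  have harith := arith_bound (L := bigLam ε₀ ^ (m : ℤ)) (L' := bigLam ε₀ ^ ((m : ℤ) - 1))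
    (sQ := shiftConst α (0, 0, 0)) (sB := shiftConst α (1, 0, 0) + shiftConst α (0, 1, 0))
    (sA := shiftConst α (0, 0, 1)) (nu := ν) (CC := C) hw0 hν.le (shiftConst_nonneg α _)
    (add_nonneg (shiftConst_nonneg α _) (shiftConst_nonneg α _)) (shiftConst_nonneg α _) hp0 B1 B2 B3 B4
  have hK : ((shiftConst α (0, 0, 0) + (shiftConst α (1, 0, 0) + shiftConst α (0, 1, 0)) +
      shiftConst α (0, 0, 1)) * (C + C ^ 2) + 2 * ν * C) * (1 + ε₀) ^ m ≤
      clockK α ν C * (1 + ε₀) ^ m := by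
    unfold clockK
    nlinarith [hw0]
  calc |2 * ⟪shellVec X (m : ℤ) t, dvec ε₀ α ν X m t⟫|
      ≤ 2 * ‖shellVec X (m : ℤ) t‖ * ‖dvec ε₀ α ν X m t‖ := hin
    _ ≤ 2 * ‖shellVec X (m : ℤ) t‖ *
          (bigLam ε₀ ^ (m : ℤ) * (shiftConst α (0, 0, 0) * ‖shellVec X (m : ℤ) t‖ ^ 2 +
            (shiftConst α (1, 0, 0) + shiftConst α (0, 1, 0)) * ‖shellVec X ((m : ℤ) + 1) t‖ *
              ‖shellVec X (m : ℤ) t‖) +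
          bigLam ε₀ ^ ((m : ℤ) - 1) * (shiftConst α (0, 0, 1) * ‖shellVec X ((m : ℤ) - 1) t‖ ^ 2) +
          ν * ((1 + ε₀) ^ m) ^ 2 * ‖shellVec X (m : ℤ) t‖) :=
        mul_le_mul_of_nonneg_left hd (by positivity)
    _ ≤ ((shiftConst α (0, 0, 0) + (shiftConst α (1, 0, 0) + shiftConst α (0, 1, 0)) +
          shiftConst α (0, 0, 1)) * (C + C ^ 2) + 2 * ν * C) * (1 + ε₀) ^ m := harith
    _ ≤ clockK α ν C * (1 + ε₀) ^ m := hK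

/-- **Lipschitz bound of the shell energy on `[0,T)`**, uniform weight `(1+ε₀)^m`. -/
theorem energy_lipschitz (hP : Pinned ε₀ α X₀ ν T C c X) (hε : 0 < ε₀) (m : ℕ) {s t : ℝ}
    (hs : s ∈ Ico 0 T) (ht : t ∈ Ico 0 T) :
    |‖shellVec X (m : ℤ) t‖ ^ 2 - ‖shellVec X (m : ℤ) s‖ ^ 2| ≤
      clockK α ν C * (1 + ε₀) ^ m * |t - s| := by
  have h := Convex.norm_image_sub_le_of_norm_hasDerivWithin_le
    (f := fun r => ‖shellVec X (m : ℤ) r‖ ^ 2)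
    (f' := fun r => 2 * ⟪shellVec X (m : ℤ) r, dvec ε₀ α ν X m r⟫) (s := Ico 0 T)
    (fun r hr => hasDerivWithinAt_energy hP (m : ℤ) hr)
    (fun r hr => by rw [Real.norm_eq_abs]; exact deriv_bound hP hε m hr) (convex_Ico 0 T) hs ht
  simpa only [Real.norm_eq_abs] using h

/-! ## The clock -/

/-- **`stub_clock` PROVED**: every critically pinned exact viscous lattice solution admits re-selected firing times
with a two-sided self-similar clock and an amplitude floor. -/
theorem stubClock_holds : StubClock := by
  intro ε₀ R α X₀ ν T C c X hε _hα hP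
  have hb : 0 < 1 + ε₀ := by linarith
  have hb1 : 1 ≤ 1 + ε₀ := by linarith
  obtain ⟨hν, hT, hc, hcd, hX0, hneg, hlaw, htypeI, hint, hpin, hfire⟩ := id hP
  have hC : 0 ≤ C := by
    have h := hpin 0 0 le_rfl hT
    exact le_trans (by positivity) h
  have hK0 : 0 < clockK α ν C := clockK_pos α hν.le hC
  -- original firing times
  choose tf htf using fun m : ℕ => hfire (m : ℤ) (by positivity)
  refine ⟨c / 2, min (c / (2 * clockK α ν C)) T, Real.sqrt (2 * C ^ 2 / c) + 1, by positivity,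
    lt_min (by positivity) hT, by positivity,
    fun m => max (tf m - c / (2 * clockK α ν C) * ((1 + ε₀) ^ (2 * m))⁻¹) 0, ?_⟩
  intro m
  obtain ⟨ht0, htT, hfl⟩ := htf m
  rw [zpow_natCast] at hfl
  have hδ0 : 0 < c / (2 * clockK α ν C) * ((1 + ε₀) ^ (2 * m))⁻¹ := by positivity
  have hτ0 : 0 ≤ max (tf m - c / (2 * clockK α ν C) * ((1 + ε₀) ^ (2 * m))⁻¹) 0 := le_max_right _ _
  have hτle : max (tf m - c / (2 * clockK α ν C) * ((1 + ε₀) ^ (2 * m))⁻¹) 0 ≤ tf m :=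
    max_le (by linarith) ht0
  have hτT : max (tf m - c / (2 * clockK α ν C) * ((1 + ε₀) ^ (2 * m))⁻¹) 0 < T :=
    lt_of_le_of_lt hτle htT
  have hgap : tf m - max (tf m - c / (2 * clockK α ν C) * ((1 + ε₀) ^ (2 * m))⁻¹) 0 ≤
      c / (2 * clockK α ν C) * ((1 + ε₀) ^ (2 * m))⁻¹ := by
    have h := le_max_left (tf m - c / (2 * clockK α ν C) * ((1 + ε₀) ^ (2 * m))⁻¹) 0
    linarith
  set τ := max (tf m - c / (2 * clockK α ν C) * ((1 + ε₀) ^ (2 * m))⁻¹) 0 with hτ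
  -- the floor survives the pull-back
  have hLip := energy_lipschitz hP hε m (s := τ) (t := tf m) ⟨hτ0, hτT⟩ ⟨ht0, htT⟩
  have hfloor : c / 2 ≤ (1 + ε₀) ^ m * ‖shellVec X (m : ℤ) τ‖ ^ 2 := by
    have h1 : (1 + ε₀) ^ m * ‖shellVec X (m : ℤ) (tf m)‖ ^ 2 - (1 + ε₀) ^ m * ‖shellVec X (m : ℤ) τ‖ ^ 2
        ≤ (1 + ε₀) ^ m * (clockK α ν C * (1 + ε₀) ^ m * (tf m - τ)) := by
      rw [← mul_sub]
      refine mul_le_mul_of_nonneg_left ?_ (pow_nonneg hb.le m)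
      rw [abs_of_nonneg (by linarith : 0 ≤ tf m - τ)] at hLip
      exact le_trans (le_abs_self _) hLip
    have h2 : (1 + ε₀) ^ m * (clockK α ν C * (1 + ε₀) ^ m * (tf m - τ)) ≤
        (1 + ε₀) ^ m * (clockK α ν C * (1 + ε₀) ^ m *
          (c / (2 * clockK α ν C) * ((1 + ε₀) ^ (2 * m))⁻¹)) :=
      mul_le_mul_of_nonneg_left (mul_le_mul_of_nonneg_left hgap (by positivity)) (by positivity)
    have h3 : (1 + ε₀) ^ m * (clockK α ν C * (1 + ε₀) ^ m *
        (c / (2 * clockK α ν C) * ((1 + ε₀) ^ (2 * m))⁻¹)) = c / 2 := by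
      field_simp
      ring
    linarith [hfl]
  -- the lower clock
  have hlow : min (c / (2 * clockK α ν C)) T * ((1 + ε₀) ^ (2 * m))⁻¹ ≤ T - τ := by
    rcases le_total (tf m - c / (2 * clockK α ν C) * ((1 + ε₀) ^ (2 * m))⁻¹) 0 with h | h
    · have hτeq : τ = 0 := by rw [hτ]; exact max_eq_right h
      rw [hτeq, sub_zero]
      calc min (c / (2 * clockK α ν C)) T * ((1 + ε₀) ^ (2 * m))⁻¹ ≤ T * 1 :=
            mul_le_mul (min_le_right _ _) (inv_le_one_of_one_le₀ (one_le_pow₀ hb1)) (by positivity)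
              hT.le
        _ = T := mul_one T
    · have hτeq : τ = tf m - c / (2 * clockK α ν C) * ((1 + ε₀) ^ (2 * m))⁻¹ := by
        rw [hτ]; exact max_eq_left h
      rw [hτeq]
      calc min (c / (2 * clockK α ν C)) T * ((1 + ε₀) ^ (2 * m))⁻¹
          ≤ c / (2 * clockK α ν C) * ((1 + ε₀) ^ (2 * m))⁻¹ :=
            mul_le_mul_of_nonneg_right (min_le_left _ _) (by positivity)
        _ ≤ T - (tf m - c / (2 * clockK α ν C) * ((1 + ε₀) ^ (2 * m))⁻¹) := by linarith
  -- the upper clock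
  have hup : T - τ ≤ (Real.sqrt (2 * C ^ 2 / c) + 1) * ((1 + ε₀) ^ (2 * m))⁻¹ := by
    have hI := htypeI (m : ℤ) τ hτ0 hτT
    rw [zpow_natCast] at hI
    have hu : 0 ≤ T - τ := by linarith
    have hw0 : 0 < (1 + ε₀) ^ m := pow_pos hb m
    have hLnn : 0 ≤ bigLam ε₀ ^ m * (T - τ) * ‖shellVec X (m : ℤ) τ‖ :=
      mul_nonneg (mul_nonneg (pow_nonneg (bigLam_pos (by linarith)).le m) hu) (norm_nonneg _)
    have h1 : ((T - τ) * ((1 + ε₀) ^ m) ^ 2) ^ 2 * (c / 2) ≤ C ^ 2 := by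
      calc ((T - τ) * ((1 + ε₀) ^ m) ^ 2) ^ 2 * (c / 2)
          ≤ ((T - τ) * ((1 + ε₀) ^ m) ^ 2) ^ 2 * ((1 + ε₀) ^ m * ‖shellVec X (m : ℤ) τ‖ ^ 2) :=
            mul_le_mul_of_nonneg_left hfloor (by positivity)
        _ = (bigLam ε₀ ^ m * (T - τ) * ‖shellVec X (m : ℤ) τ‖) ^ 2 := by
            rw [mul_pow, mul_pow, mul_pow, bigLam_pow_sq hε m]; ring
        _ ≤ C ^ 2 := pow_le_pow_left₀ hLnn hI 2
    have h2 : ((T - τ) * ((1 + ε₀) ^ m) ^ 2) ^ 2 ≤ 2 * C ^ 2 / c := by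
      rw [le_div_iff₀ hc]; linarith [h1]
    have h3 : (T - τ) * ((1 + ε₀) ^ m) ^ 2 ≤ Real.sqrt (2 * C ^ 2 / c) :=
      le_trans (le_abs_self _) (Real.abs_le_sqrt h2)
    have hw2 : ((1 + ε₀) ^ m) ^ 2 = (1 + ε₀) ^ (2 * m) := by rw [← pow_mul, Nat.mul_comm]
    calc T - τ = ((T - τ) * ((1 + ε₀) ^ m) ^ 2) * (((1 + ε₀) ^ m) ^ 2)⁻¹ := by field_simp
      _ ≤ (Real.sqrt (2 * C ^ 2 / c) + 1) * (((1 + ε₀) ^ m) ^ 2)⁻¹ :=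
          mul_le_mul_of_nonneg_right (by linarith) (by positivity)
      _ = (Real.sqrt (2 * C ^ 2 / c) + 1) * ((1 + ε₀) ^ (2 * m))⁻¹ := by rw [hw2]
  exact ⟨hτ0, hτT, hlow, hup, hfloor⟩

end Summit.NavierStokesRegularity.NavierStokesRegularity.Cruxes.MinimalBlowupExtraction.ClockedFrames

end
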